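import Literature.Analysis.Calculus.SmoothCutoff
import HarnessLib

/-!
# Crux `GroundBarta.GroundBartaFloor` (stmt-RiemannHypothesis-18389), line `inner-cutoff-strong-EL`:
stub 1 — inner plateau cut-offs

For a window `a` and a collar width `0 < η < a` the rescaled plateau cut-off
`θ(t) = cutoff (a/η) (t/η)` (`Literature.Analysis.Calculus.cutoff R`, `= 1` on `|s| ≤ R - 1`,
`= 0` for `|s| ≥ R`, smooth, `|cutoff'| ≤ D` uniformly in `R`) is smooth, even, `= 1` on
`[-(a-η), a-η]`, `= 0` for `|t| ≥ a`, takes values in `[0, 1]`, and `|θ'| ≤ D/η`.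
RH-free; Mathlib + `Literature.Analysis.Calculus.SmoothCutoff` only.
-/

set_option linter.dupNamespace false

noncomputable section

open Set

namespace Summit.RiemannHypothesis.RiemannHypothesis.Theorems.GroundBartaFloor

open Literature.Analysis.Calculus

/-- The rescaled cut-off is even: `cutoff R (-s) = cutoff R s`. -/
theorem ic_cutoff_neg (R s : ℝ) : cutoff R (-s) = cutoff R s := by
  unfold cutoff
  rw [mul_comm]
  congr 1 <;> ring_nf

/-- **Stub 1 of line `inner-cutoff-strong-EL` — inner plateau cut-offs.**  There is `D ≥ 0` such
that for all `0 < η < a` some smooth even `θ : ℝ → ℝ` satisfies `θ = 1` on `[-(a-η), a-η]`, `θ = 0`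
for `|t| ≥ a`, `0 ≤ θ ≤ 1` and `|θ'| ≤ D/η` (namely `θ(t) = cutoff (a/η) (t/η)`). -/
theorem stub_groundCutoff :
    ∃ D : ℝ, 0 ≤ D ∧ ∀ a η : ℝ, 0 < η → η < a → ∃ θ : ℝ → ℝ, ContDiff ℝ (⊤ : ℕ∞) θ ∧
      (∀ t, |t| ≤ a - η → θ t = 1) ∧ (∀ t, a ≤ |t| → θ t = 0) ∧ (∀ t, 0 ≤ θ t) ∧ (∀ t, θ t ≤ 1) ∧
      (∀ t, θ (-t) = θ t) ∧ (∀ t, |deriv θ t| ≤ D / η) := by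
  obtain ⟨D, hD0, hD⟩ := exists_bound_deriv_cutoff
  refine ⟨D, hD0, fun a η hη _ => ⟨fun t => cutoff (a / η) (t / η), ?_, ?_, ?_, ?_, ?_, ?_, ?_⟩⟩
  · exact (contDiff_cutoff _).comp (contDiff_id.div_const η)
  · intro t ht
    apply cutoff_eq_one
    rw [abs_div, abs_of_pos hη, div_le_iff₀ hη, sub_mul, div_mul_cancel₀ _ hη.ne', one_mul]
    exact ht
  · intro t ht
    apply cutoff_eq_zero
    rw [abs_div, abs_of_pos hη, le_div_iff₀ hη, div_mul_cancel₀ _ hη.ne']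
    exact ht
  · exact fun t => cutoff_nonneg _ _
  · exact fun t => cutoff_le_one _ _
  · intro t
    simp only [neg_div]
    exact ic_cutoff_neg _ _
  · intro t
    have hd : HasDerivAt (fun t => cutoff (a / η) (t / η))
        (deriv (cutoff (a / η)) (t / η) * (1 / η)) t := by
      have h1 : HasDerivAt (fun t : ℝ => t / η) (1 / η) t := by
        simpa using (hasDerivAt_id t).div_const η
      exact ((contDiff_cutoff (a / η) (n := 1)).differentiable (by simp) _).hasDerivAt.comp t h1
    rw [hd.deriv, abs_mul, abs_of_pos (by positivity : (0 : ℝ) < 1 / η), mul_one_div]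
    exact div_le_div_of_nonneg_right (hD _ _) hη.le

end Summit.RiemannHypothesis.RiemannHypothesis.Theorems.GroundBartaFloor

end
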